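import Summits.Ventures.LatticeQCDFlow.Scaling.MinNetworkElimination

/-!
HONEST FRAMING: exact (Metropolis-corrected) sampling algorithms for lattice gauge theory; figures
of merit are autocorrelation/cost numbers at stated couplings and volumes; no continuum-physics
claim.

# MinNetworkMonotone — ENTRYWISE ANTITONICITY OF THE GREEN KERNEL OF A WEIGHTED MIN-CONDUCTANCE NETWORK: IF `ρ ≤ ρ'` POINTWISE THEN, FOR THE SAME NON-NEGATIVE SOURCE, THE
# POTENTIALS SATISFY `ψ ≤ φ` AT EVERY NODE — DEEPENING ANY SET OF NODES LOWERS EVERY POTENTIAL (CONJECTURE M OF MEMO-gen37 IN NETWORK FORM; lean-2 GEN-38, ours)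

Venture-side (OURS).  Cell `lqcd-flow` (pub-lqcd), unit `pub-lqcd-lean-2-g38`, 2026-08-30.  Chapter W (item 1 (i) at finite swap odds), file 25.  Setting of file 24 (`MinNetworkElimination`):
weights `N > 0`, depths `ρ > 0` on a finite node set `A`, ground factor `κ > 0`, edge factor `β ≥ 0`, operator `(L_{A,ρ}φ)(v) = κN_vρ_vφ(v) + βΣ_{u∈A∖v}N_uN_v·min(ρ_u,ρ_v)(φ(v) − φ(u))`
(hypothesis-equation).  THE COMPARISON THEOREM (`minNet_antitone`): if `ρ ≤ ρ'` on `A`, `f ≥ 0` on `A`, `L_{A,ρ}φ = f` and `L_{A,ρ'}ψ = f` on `A`, then `ψ ≤ φ` on `A`.  PROOF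
(MEMO-gen38 §2): induction on `|A|`.  STEP THROUGH A COMMON SHALLOWEST NODE (`minNet_step`): if `o` is shallowest for both `ρ` and `ρ'`, file 24 restricts both systems to `A∖o` —
same class, depths `ρ + c ≤ ρ' + c'` (`c = θN_oρ_o ≤ θN_oρ'_o = c'`, the SAME `θ = β/(κ + βΣ_{u≠o}N_u)`), the SAME source `f + θf_oN ≥ 0` — so the induction hypothesis gives `ψ ≤ φ`
off `o`, and the eliminated rows `φ(o) = f_o/(N_oρ_oD) + θΣN_uφ(u) ≥ f_o/(N_oρ'_oD) + θΣN_uψ(u) = ψ(o)` finish.  GENERAL PAIRS: with `m' = min_A ρ'` attained at `o'` and `o` a minimiser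
of `ρ`, the intermediate depths `ρ¹ = max(ρ, m')` satisfy `ρ ≤ ρ¹ ≤ ρ'`, `o` is shallowest for `ρ` and `ρ¹`, `o'` is shallowest for `ρ¹` and `ρ'`; a potential `χ` for `ρ¹` exists
by file 24 (`minNet_exists`), and two common-node steps give `ψ ≤ χ ≤ φ`.  COROLLARIES: potentials are unique (`minNet_unique`) and non-negative for non-negative sources
(`minNet_nonneg`).  For the tagged hub chains of files 14–23 (`ρ = 1/W`, the tagged particle of `Y` deeper than that of `X`, everything else equal) this is CONJECTURE M of
MEMO-gen37 in its discounted form, for every start including ★ and every target (file 26 does the bookkeeping; the diagonal is file 20).  Hypothesis-equations, no definitions.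

## What is proved

* `minNet_sub`, `minNet_smul`, `minNet_zero`, **`minNet_step`**, **`minNet_antitone`**, `minNet_unique`, `minNet_nonneg`.

Reading (no numerics implied): Rayleigh's monotonicity law is about the DIAGONAL of the Green kernel and holds for every network; OFF the diagonal a conductance increase can raise
a potential (series paths), and the min-kernel structure (every node tied to all deeper nodes by its own depth) is what excludes it.  Literature grade (cell rule): OWN, elementary;
nothing cited as a fact; no new bib keys.
-/

open Finset

namespace Summit.Ventures.LatticeQCDFlow.Scaling

section MinNetMono
variable {ι : Type*} [DecidableEq ι]
variable {N : ι → ℝ} {β κ : ℝ} {L : Finset ι → (ι → ℝ) → (ι → ℝ) → ι → ℝ}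

/-- The operator is linear in the potential: `L(φ − ψ) = Lφ − Lψ`. [ours] -/
theorem minNet_sub (hL : ∀ A ρ φ v, L A ρ φ v = κ * (N v * ρ v) * φ v + β * ∑ u ∈ A.erase v, N u * N v * min (ρ u) (ρ v) * (φ v - φ u))
    (A : Finset ι) (ρ φ ψ : ι → ℝ) (v : ι) : L A ρ (fun u => φ u - ψ u) v = L A ρ φ v - L A ρ ψ v := by
  rw [hL, hL, hL]
  have e : ∑ u ∈ A.erase v, N u * N v * min (ρ u) (ρ v) * ((φ v - ψ v) - (φ u - ψ u))
      = ∑ u ∈ A.erase v, N u * N v * min (ρ u) (ρ v) * (φ v - φ u) - ∑ u ∈ A.erase v, N u * N v * min (ρ u) (ρ v) * (ψ v - ψ u) := by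
    rw [← sum_sub_distrib]; exact sum_congr rfl fun u _ => by ring
  rw [e]; ring

/-- The operator is homogeneous in the potential: `L(cφ) = c·Lφ`. [ours] -/
theorem minNet_smul (hL : ∀ A ρ φ v, L A ρ φ v = κ * (N v * ρ v) * φ v + β * ∑ u ∈ A.erase v, N u * N v * min (ρ u) (ρ v) * (φ v - φ u))
    (A : Finset ι) (ρ φ : ι → ℝ) (c : ℝ) (v : ι) : L A ρ (fun u => c * φ u) v = c * L A ρ φ v := by
  rw [hL, hL]
  have e : ∑ u ∈ A.erase v, N u * N v * min (ρ u) (ρ v) * (c * φ v - c * φ u) = c * ∑ u ∈ A.erase v, N u * N v * min (ρ u) (ρ v) * (φ v - φ u) := by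
    rw [mul_sum]; exact sum_congr rfl fun u _ => by ring
  rw [e]; ring

/-- The zero potential has zero image. [ours] -/
theorem minNet_zero (hL : ∀ A ρ φ v, L A ρ φ v = κ * (N v * ρ v) * φ v + β * ∑ u ∈ A.erase v, N u * N v * min (ρ u) (ρ v) * (φ v - φ u))
    (A : Finset ι) (ρ : ι → ℝ) (v : ι) : L A ρ (fun _ => 0) v = 0 := by
  rw [hL]; simp

/-- **THE STEP THROUGH A COMMON SHALLOWEST NODE:** `o ∈ A` shallowest for both `ρ ≤ ρ'`, `f ≥ 0`, `L_{A,ρ}φ = f`, `L_{A,ρ'}ψ = f`, and the comparison theorem on `A∖o` ⇒ `ψ ≤ φ`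
on `A`. [ours] -/
theorem minNet_step (hL : ∀ A ρ φ v, L A ρ φ v = κ * (N v * ρ v) * φ v + β * ∑ u ∈ A.erase v, N u * N v * min (ρ u) (ρ v) * (φ v - φ u))
    (hκ : 0 < κ) (hβ : 0 ≤ β) {A : Finset ι} {o : ι} (ho : o ∈ A) (hN : ∀ v ∈ A, 0 < N v)
    {ρ ρ' f φ ψ : ι → ℝ} (hρ : ∀ v ∈ A, 0 < ρ v) (hle : ∀ v ∈ A, ρ v ≤ ρ' v) (hf : ∀ v ∈ A, 0 ≤ f v)
    (hmin : ∀ u ∈ A, ρ o ≤ ρ u) (hmin' : ∀ u ∈ A, ρ' o ≤ ρ' u)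
    (hφ : ∀ v ∈ A, L A ρ φ v = f v) (hψ : ∀ v ∈ A, L A ρ' ψ v = f v)
    (ih : ∀ (ρ ρ' f φ ψ : ι → ℝ), (∀ v ∈ A.erase o, 0 < ρ v) → (∀ v ∈ A.erase o, ρ v ≤ ρ' v) → (∀ v ∈ A.erase o, 0 ≤ f v) →
      (∀ v ∈ A.erase o, L (A.erase o) ρ φ v = f v) → (∀ v ∈ A.erase o, L (A.erase o) ρ' ψ v = f v) → ∀ v ∈ A.erase o, ψ v ≤ φ v) :
    ∀ v ∈ A, ψ v ≤ φ v := by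
  have hS0 : 0 ≤ ∑ u ∈ A.erase o, N u := sum_nonneg fun u hu => (hN u (mem_of_mem_erase hu)).le
  have hD0 : 0 < κ + β * ∑ u ∈ A.erase o, N u := add_pos_of_pos_of_nonneg hκ (mul_nonneg hβ hS0)
  have hθ0 : 0 ≤ β / (κ + β * ∑ u ∈ A.erase o, N u) := div_nonneg hβ hD0.le
  have hNo : 0 < N o := hN o ho
  have hρo : 0 < ρ o := hρ o ho
  have hρ'o : 0 < ρ' o := lt_of_lt_of_le hρo (hle o ho)
  -- restrict both systems
  obtain ⟨hφo, hφr⟩ := minNet_restrict hL ho hmin rfl hD0.ne' hNo.ne' hρo.ne' rfl rfl hφ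
  obtain ⟨hψo, hψr⟩ := minNet_restrict hL ho hmin' rfl hD0.ne' hNo.ne' hρ'o.ne' rfl rfl hψ
  -- the induction hypothesis on the reduced pair (same θ, same source, shifted depths)
  have hcc : β / (κ + β * ∑ u ∈ A.erase o, N u) * (N o * ρ o) ≤ β / (κ + β * ∑ u ∈ A.erase o, N u) * (N o * ρ' o) :=
    mul_le_mul_of_nonneg_left (mul_le_mul_of_nonneg_left (hle o ho) hNo.le) hθ0
  have hc0 : 0 ≤ β / (κ + β * ∑ u ∈ A.erase o, N u) * (N o * ρ o) := mul_nonneg hθ0 (mul_nonneg hNo.le hρo.le)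
  have hred := ih (fun u => ρ u + β / (κ + β * ∑ u ∈ A.erase o, N u) * (N o * ρ o))
    (fun u => ρ' u + β / (κ + β * ∑ u ∈ A.erase o, N u) * (N o * ρ' o))
    (fun v => f v + β / (κ + β * ∑ u ∈ A.erase o, N u) * N v * f o) φ ψ
    (fun v hv => add_pos_of_pos_of_nonneg (hρ v (mem_of_mem_erase hv)) hc0)
    (fun v hv => add_le_add (hle v (mem_of_mem_erase hv)) hcc)
    (fun v hv => add_nonneg (hf v (mem_of_mem_erase hv)) (mul_nonneg (mul_nonneg hθ0 (hN v (mem_of_mem_erase hv)).le) (hf o ho)))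
    hφr hψr
  intro v hvA
  by_cases hvo : v = o
  · subst hvo
    rw [hφo, hψo]
    have hden : N v * ρ v * (κ + β * ∑ u ∈ A.erase v, N u) ≤ N v * ρ' v * (κ + β * ∑ u ∈ A.erase v, N u) :=
      mul_le_mul_of_nonneg_right (mul_le_mul_of_nonneg_left (hle v ho) hNo.le) hD0.le
    have h1 : f v / (N v * ρ' v * (κ + β * ∑ u ∈ A.erase v, N u)) ≤ f v / (N v * ρ v * (κ + β * ∑ u ∈ A.erase v, N u)) :=
      div_le_div_of_nonneg_left (hf v ho) (by positivity) hden
    have h2 : ∑ u ∈ A.erase v, N u * ψ u ≤ ∑ u ∈ A.erase v, N u * φ u :=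
      sum_le_sum fun u hu => mul_le_mul_of_nonneg_left (hred u hu) (hN u (mem_of_mem_erase hu)).le
    exact add_le_add h1 (mul_le_mul_of_nonneg_left h2 hθ0)
  · exact hred v (mem_erase.mpr ⟨hvo, hvA⟩)

/-- **THE COMPARISON THEOREM (ENTRYWISE ANTITONICITY OF THE GREEN KERNEL):** for weights `N > 0`, depths `0 < ρ ≤ ρ'` on `A`, a non-negative source `f` and potentials
`L_{A,ρ}φ = f`, `L_{A,ρ'}ψ = f` on `A`: **`ψ(v) ≤ φ(v)` for every `v ∈ A`.** [ours] -/
theorem minNet_antitone (hL : ∀ A ρ φ v, L A ρ φ v = κ * (N v * ρ v) * φ v + β * ∑ u ∈ A.erase v, N u * N v * min (ρ u) (ρ v) * (φ v - φ u))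
    (hκ : 0 < κ) (hβ : 0 ≤ β) :
    ∀ (n : ℕ) (A : Finset ι), A.card = n → (∀ v ∈ A, 0 < N v) → ∀ (ρ ρ' f φ ψ : ι → ℝ), (∀ v ∈ A, 0 < ρ v) → (∀ v ∈ A, ρ v ≤ ρ' v) →
      (∀ v ∈ A, 0 ≤ f v) → (∀ v ∈ A, L A ρ φ v = f v) → (∀ v ∈ A, L A ρ' ψ v = f v) → ∀ v ∈ A, ψ v ≤ φ v := by
  intro n
  induction n with
  | zero =>
    intro A hA _ ρ ρ' f φ ψ _ _ _ _ _
    rw [Finset.card_eq_zero] at hA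
    subst hA
    simp
  | succ n ih =>
    intro A hA hN ρ ρ' f φ ψ hρ hle hf hφ hψ
    have hne : A.Nonempty := by rw [← Finset.card_pos, hA]; exact Nat.succ_pos n
    obtain ⟨o, ho, hmin⟩ := exists_min_image A ρ hne
    obtain ⟨o', ho', hmin'⟩ := exists_min_image A ρ' hne
    have hcard : ∀ w ∈ A, (A.erase w).card = n := fun w hw => by rw [card_erase_of_mem hw, hA]; simp
    have ihA : ∀ w ∈ A, ∀ (ρ ρ' f φ ψ : ι → ℝ), (∀ v ∈ A.erase w, 0 < ρ v) → (∀ v ∈ A.erase w, ρ v ≤ ρ' v) → (∀ v ∈ A.erase w, 0 ≤ f v) →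
        (∀ v ∈ A.erase w, L (A.erase w) ρ φ v = f v) → (∀ v ∈ A.erase w, L (A.erase w) ρ' ψ v = f v) → ∀ v ∈ A.erase w, ψ v ≤ φ v :=
      fun w hw => ih (A.erase w) (hcard w hw) (fun v hv => hN v (mem_of_mem_erase hv))
    -- the intermediate depths `ρ¹ = max ρ (min ρ')`
    have hρ1pos : ∀ v ∈ A, 0 < max (ρ v) (ρ' o') := fun v hv => lt_max_of_lt_left (hρ v hv)
    have hle1 : ∀ v ∈ A, ρ v ≤ max (ρ v) (ρ' o') := fun v _ => le_max_left _ _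
    have hle2 : ∀ v ∈ A, max (ρ v) (ρ' o') ≤ ρ' v := fun v hv => max_le (hle v hv) (hmin' v hv)
    have hmin1o : ∀ u ∈ A, max (ρ o) (ρ' o') ≤ max (ρ u) (ρ' o') := fun u _ => by
      rw [max_eq_right ((hmin o' ho').trans (hle o' ho'))]; exact le_max_right _ _
    have hmin1o' : ∀ u ∈ A, max (ρ o') (ρ' o') ≤ max (ρ u) (ρ' o') := fun u _ => by
      rw [max_eq_right (hle o' ho')]; exact le_max_right _ _
    obtain ⟨χ, hχ⟩ := minNet_exists hL hκ hβ (n + 1) A hA hN (fun v => max (ρ v) (ρ' o')) f hρ1pos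
    have h1 : ∀ v ∈ A, χ v ≤ φ v := minNet_step hL hκ hβ ho hN hρ hle1 hf hmin hmin1o hφ hχ (ihA o ho)
    have h2 : ∀ v ∈ A, ψ v ≤ χ v := minNet_step hL hκ hβ ho' hN hρ1pos hle2 hf hmin1o' hmin' hχ hψ (ihA o' ho')
    exact fun v hv => (h2 v hv).trans (h1 v hv)

/-- **Uniqueness of potentials.** [ours] -/
theorem minNet_unique (hL : ∀ A ρ φ v, L A ρ φ v = κ * (N v * ρ v) * φ v + β * ∑ u ∈ A.erase v, N u * N v * min (ρ u) (ρ v) * (φ v - φ u))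
    (hκ : 0 < κ) (hβ : 0 ≤ β) {A : Finset ι} (hN : ∀ v ∈ A, 0 < N v) {ρ f φ ψ : ι → ℝ} (hρ : ∀ v ∈ A, 0 < ρ v)
    (hφ : ∀ v ∈ A, L A ρ φ v = f v) (hψ : ∀ v ∈ A, L A ρ ψ v = f v) : ∀ v ∈ A, φ v = ψ v := by
  have hδ : ∀ v ∈ A, L A ρ (fun u => φ u - ψ u) v = 0 := fun v hv => by rw [minNet_sub hL, hφ v hv, hψ v hv, sub_self]
  have h0 : ∀ v ∈ A, L A ρ (fun _ => (0 : ℝ)) v = 0 := fun v _ => minNet_zero hL A ρ v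
  have h1 := minNet_antitone hL hκ hβ A.card A rfl hN ρ ρ (fun _ => 0) (fun u => φ u - ψ u) (fun _ => 0) hρ (fun _ _ => le_rfl) (fun _ _ => le_rfl) hδ h0
  have h2 := minNet_antitone hL hκ hβ A.card A rfl hN ρ ρ (fun _ => 0) (fun _ => 0) (fun u => φ u - ψ u) hρ (fun _ _ => le_rfl) (fun _ _ => le_rfl) h0 hδ
  intro v hv
  have a := h1 v hv
  have b := h2 v hv
  linarith

/-- **Non-negativity of potentials** for non-negative sources (induction through the eliminated row). [ours] -/
theorem minNet_nonneg (hL : ∀ A ρ φ v, L A ρ φ v = κ * (N v * ρ v) * φ v + β * ∑ u ∈ A.erase v, N u * N v * min (ρ u) (ρ v) * (φ v - φ u))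
    (hκ : 0 < κ) (hβ : 0 ≤ β) :
    ∀ (n : ℕ) (A : Finset ι), A.card = n → (∀ v ∈ A, 0 < N v) → ∀ (ρ f φ : ι → ℝ), (∀ v ∈ A, 0 < ρ v) → (∀ v ∈ A, 0 ≤ f v) →
      (∀ v ∈ A, L A ρ φ v = f v) → ∀ v ∈ A, 0 ≤ φ v := by
  intro n
  induction n with
  | zero =>
    intro A hA _ ρ f φ _ _ _
    rw [Finset.card_eq_zero] at hA
    subst hA
    simp
  | succ n ih =>
    intro A hA hN ρ f φ hρ hf hφ
    have hne : A.Nonempty := by rw [← Finset.card_pos, hA]; exact Nat.succ_pos n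
    obtain ⟨o, ho, hmin⟩ := exists_min_image A ρ hne
    have hS0 : 0 ≤ ∑ u ∈ A.erase o, N u := sum_nonneg fun u hu => (hN u (mem_of_mem_erase hu)).le
    have hD0 : 0 < κ + β * ∑ u ∈ A.erase o, N u := add_pos_of_pos_of_nonneg hκ (mul_nonneg hβ hS0)
    have hθ0 : 0 ≤ β / (κ + β * ∑ u ∈ A.erase o, N u) := div_nonneg hβ hD0.le
    have hNo : 0 < N o := hN o ho
    have hρo : 0 < ρ o := hρ o ho
    obtain ⟨hφo, hφr⟩ := minNet_restrict hL ho hmin rfl hD0.ne' hNo.ne' hρo.ne' rfl rfl hφ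
    have hc0 : 0 ≤ β / (κ + β * ∑ u ∈ A.erase o, N u) * (N o * ρ o) := mul_nonneg hθ0 (mul_nonneg hNo.le hρo.le)
    have hcard : (A.erase o).card = n := by rw [card_erase_of_mem ho, hA]; simp
    have hred := ih (A.erase o) hcard (fun v hv => hN v (mem_of_mem_erase hv)) _ _ φ
      (fun v hv => add_pos_of_pos_of_nonneg (hρ v (mem_of_mem_erase hv)) hc0)
      (fun v hv => add_nonneg (hf v (mem_of_mem_erase hv)) (mul_nonneg (mul_nonneg hθ0 (hN v (mem_of_mem_erase hv)).le) (hf o ho))) hφr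
    intro v hvA
    by_cases hvo : v = o
    · subst hvo
      rw [hφo]
      have h2 : 0 ≤ ∑ u ∈ A.erase v, N u * φ u := sum_nonneg fun u hu => mul_nonneg (hN u (mem_of_mem_erase hu)).le (hred u hu)
      have h1 : 0 ≤ f v / (N v * ρ v * (κ + β * ∑ u ∈ A.erase v, N u)) := div_nonneg (hf v ho) (by positivity)
      exact add_nonneg h1 (mul_nonneg hθ0 h2)
    · exact hred v (mem_erase.mpr ⟨hvo, hvA⟩)

end MinNetMono

end Summit.Ventures.LatticeQCDFlow.Scaling
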